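/-
Copyright (c) 2026 the pub-hodgecm-mathlib formalisation cell (harness21).  Prover seat hodgecm-mathlib-R90-CS-p03 (g0) for R90-TF section S8 «ContSpec-n½» (planner R90-CS-plan (g0), hand
«T2 FINAL ASSEMBLY» 16:19:18Z): ★ T1 `K2E1EisensteinResidueLevelConstantU2` (K2E1-p10 (g3)) with its three T-letters (L-CT), (L-AE), (L-ORTH) DISCHARGED BY NAME.
-/
import Summits.HodgeConjecture.HodgeConjecture.Theorems.K2E1EisensteinResidueLevelConstantU2                 -- ★ T1 p861752: `residueValue_eq_const_of_letters_cm_two`, `residue_detTwist_eq_const_mul_of_letters_cm_two`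
import Summits.HodgeConjecture.HodgeConjecture.Theorems.K2E1ContinuedEisensteinResidueConstantTermLevelUTwo    -- ★ (L-CT) p861749 `integrableOn_and_setIntegral_residueValue_sub_eq_zero_level`
import Summits.HodgeConjecture.HodgeConjecture.Theorems.K2E1ContinuedEisensteinResidueFunctionLevelUTwo        -- ★ (L-AE) p861785 `ae_eq_residueValue_sub_indicator_level`
import Summits.HodgeConjecture.HodgeConjecture.Theorems.K2E1TruncatedEisensteinCuspOrthogonalLevelCMTwo       -- ★ (L-ORTH) p861850 `horth_level_cm_two_of_letters₀` (this seat)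
import Summits.HodgeConjecture.HodgeConjecture.Theorems.K2E1EisensteinConstantTermIntertwinedBoundLevelU2     -- ★ p861836 (R90-C14-p01): the tail letter `hMbd`
import Summits.HodgeConjecture.HodgeConjecture.Theorems.K2E1MaassSelbergPoleControlSphericalCMTwoArch          -- ★ p858xxx `exists_bound_sub_borelConstantTerm_sphericalEisenstein_cm_two` (the SPHERICAL `hdec`, letter-free)
import Literature.NumberTheory.NumberFields.CMFieldTotallyNegativeGenerator                                   -- ★ `IsCMField.exists_complexConj_ne` (a trace-zero `δ ≠ 0`)
import HarnessLib

/-!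
# K2·E1 ∕ R90·S8 — `K2E1EisensteinResidueLevelConstantU2Final` (T2 FINAL ASSEMBLY, `U(1,1)_{L/L⁺}`): **THE RESIDUE AT `z = 1` OF A LEVEL-`K′` FLAT EISENSTEIN SERIES `E(φ₁H^z)` IS THE
# CONSTANT FUNCTION `r`** — ★ T1's three T-letters discharged by name; plus the `det`-twist corollary

Cell `pub/hodgecm-mathlib`, crux h413 = `stmt-HodgeConjecture-24833`, route of record `HCCMUnconditional`; R90-TF section S8 «ContSpec-n½», socket S8B#4 road («`L²_res(U(Φ₂)) = ⊕ ℂ·ψ∘det`»,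
ROAD-S8B2 R5∕R6-feed: the residual constituents at level are the `ψ∘det` lines).  THEOREMS ONLY (no `def`, no `instance`, no notation, no named-fact hypothesis, no `sorry`; default
heartbeats); lane `--supports stmt-HodgeConjecture-24833 --as helper` (count-neutral).  Closes no socket.

THE MATHEMATICS ([MoeglinWaldspurger1995] IV.1.11 with II.1.7, I.2.13, I.2.18; [Langlands1976] §7; [BernsteinLapid2019] §4).  ★ T1 `residueValue_eq_const_of_letters_cm_two` proves: if the
residue function `R(g) = Res_{z=1} Ẽ(z)(g)` of a continued level-`K′` Eisenstein series has (L-CT) constant term `≡ r` along `N` for every Haar measure and fundamental domain, (L-AE) the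
`L²` residue class `Res_T` of the truncated family is a.e. `R̃ − r·𝟙_{T<w₁}`, and (L-ORTH) `Res_T + r·[𝟙_{T<w₁}] ⊥` every cusp form, then `R ≡ r`.  THIS FILE feeds the three letters from
the tree: (L-CT) ★ `integrableOn_and_setIntegral_residueValue_sub_eq_zero_level` (R90-C14-p01), (L-AE) ★ `ae_eq_residueValue_sub_indicator_level` (R90-C14-p01), (L-ORTH) ★
`horth_level_cm_two_of_letters₀` (this seat) — whose own two letters are discharged here: the TAIL bound `hMbd` by ★ `exists_bound_norm_borelConstantTerm_sub_flatSectionU_cm_two`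
(R90-C14-p01) and the SPHERICAL (Tr) letter `hTr` by §1 below (★ spherical `hdec` `exists_bound_sub_borelConstantTerm_sphericalEisenstein_cm_two` + ★
`memLp_quotFun_truncation_eisensteinSeriesU_flatSectionU_cm_two`).  What remains as hypotheses is EXACTLY the binder list of the spherical ★ `residueValue_eq_const_cm_two` (p860098) with
the constant section replaced by a continuous bounded left-`N(𝔸)`∕`B(L⁺)`-invariant `φ₁`: the continuation exports (E1)(E2)(E4)(E2-bd)(Ecinv) of `Ẽ` on `D`, the level constant-term letter
(E3′) `Ẽ(z)_B = φ₁H^z + ψ(z,·)H^{1−z}` with its pole letter `(z−1)ψ(z,g) → r`, the pole function `F` of `(z−1)Ẽ(z)(g)` at `1`, and the operator road's holomorphic `L²` family `F_T =ᵐ Λ^TẼ`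
with residue class `Res_T`.
* §1 **`memLp_quotFun_truncation_sphericalEisenstein_cm_two`** — `Λ^T E(φ₀H^σ) ∈ L²(μ)` for every real `σ > 1`, `T ≥ 1`, every constant `φ₀` (letter-free);
* §2 **`residueValue_eq_const_level_cm_two`** — THE HEAD: `Res_{z=1} Ẽ(z)(g) = r` for every `g`;
* §3 **`residue_detTwist_eq_const_mul_level_cm_two`** — the `det`-twist: `Res_{z=1}(Ẽ(z)(g)·Θ(g)) = r·Θ(g)` for every unitary automorphic character `Θ` (★ T1 §2).
HONEST LABEL: HC_CM is proved only modulo the 7 printed citations (2 remaining named inputs: hLiu418 = `stmt-HodgeConjecture-24832`, h413 = `stmt-HodgeConjecture-24833`) until rung 0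
closes; this file asserts no named fact and closes no socket; the heads are CONDITIONAL on the continuation∕operator-road∕pole binders listed above (no T-letter, no `hdec`, no (Tr)).
References: [MoeglinWaldspurger1995] I.2.13, I.2.18, II.1.7, IV.1.11 · [Langlands1976] §7 · [BernsteinLapid2019] §4 · [Rogawski1990] §13.9 p. 229 (i).
-/

set_option autoImplicit false
-- the mandated namespace repeats the single-problem summit's segment (`HodgeConjecture.HodgeConjecture`)
set_option linter.dupNamespace false

noncomputable section

open MeasureTheory Measure NumberField IsDedekindDomain Set Filter Topology Metric
open scoped ENNReal NNReal InnerProductSpace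
open Literature.NumberTheory.Automorphic Literature.NumberTheory.Automorphic.UnitaryGroup AdelicGroupData
open Summit.HodgeConjecture.HodgeConjecture.Cruxes.H413.K2E1BorelEisensteinU
open Summit.HodgeConjecture.HodgeConjecture.Cruxes.H413.K2E1BLBorelSpacesU2Defs
open Summit.HodgeConjecture.HodgeConjecture.Cruxes.H413.K2E1SphericalEisensteinResidueOrthogonalU (memLp_quotFun_siegelIndicator)
open Summit.HodgeConjecture.HodgeConjecture.Cruxes.H413.K2E1EisensteinResidueLevelConstantU2 (residueValue_eq_const_of_letters_cm_two residue_detTwist_eq_const_mul_of_letters_cm_two)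
open Summit.HodgeConjecture.HodgeConjecture.Cruxes.H413.K2E1ContinuedEisensteinResidueConstantTermLevelUTwo (integrableOn_and_setIntegral_residueValue_sub_eq_zero_level)
open Summit.HodgeConjecture.HodgeConjecture.Cruxes.H413.K2E1ContinuedEisensteinResidueFunctionLevelUTwo (ae_eq_residueValue_sub_indicator_level)
open Summit.HodgeConjecture.HodgeConjecture.Cruxes.H413.K2E1TruncatedEisensteinCuspOrthogonalLevelCMTwo (horth_level_cm_two_of_letters₀)
open Summit.HodgeConjecture.HodgeConjecture.Cruxes.H413.K2E1EisensteinConstantTermIntertwinedBoundLevelU2 (exists_bound_norm_borelConstantTerm_sub_flatSectionU_cm_two)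
open Summit.HodgeConjecture.HodgeConjecture.Cruxes.H413.K2E1MaassSelbergPoleControlSphericalCMTwoArch (exists_bound_sub_borelConstantTerm_sphericalEisenstein_cm_two)
open Summit.HodgeConjecture.HodgeConjecture.Cruxes.H413.K2E1TruncatedEisensteinBoundedCMTwo (memLp_quotFun_truncation_eisensteinSeriesU_flatSectionU_cm_two)

namespace Summit.HodgeConjecture.HodgeConjecture.Cruxes.H413.K2E1EisensteinResidueLevelConstantU2Final

variable (L : Type) [Field L] [NumberField L] [IsCMField L]
variable [MeasurableSpace (quasiSplit (↥(maximalRealSubfield L)) L (IsCMField.complexConj L) 2).Adelic] [BorelSpace (quasiSplit (↥(maximalRealSubfield L)) L (IsCMField.complexConj L) 2).Adelic]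

/-! ## §1 The spherical (Tr) letter, letter-free: `Λ^T E(φ₀H^σ) ∈ L²(μ)` for real `σ > 1` -/

/-- **`Λ^T E(φ₀H^σ) ∈ L²(X, μ)` (indeed every `L^p`) for every finite measure on the automorphic quotient of `U(J₂)`, every constant `φ₀`, `T ≥ 1`, real `σ > 1`** — ★
`memLp_quotFun_truncation_eisensteinSeriesU_flatSectionU_cm_two` with its decay letter `hdec` DISCHARGED by the spherical ★ `exists_bound_sub_borelConstantTerm_sphericalEisenstein_cm_two`
(compact `Kc := {σ}`, archimedean order `m := [L⁺:ℚ] + 1`, a trace-zero `δ ≠ 0` from ★ `IsCMField.exists_complexConj_ne`). [cite: MoeglinWaldspurger1995, I.2.13, II.1.7] -/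
theorem memLp_quotFun_truncation_sphericalEisenstein_cm_two
    (ν : Measure ↥(adelicUnipotent (↥(maximalRealSubfield L)) L (IsCMField.complexConj L) 2)) [ν.IsHaarMeasure]
    {𝓕 : Set ↥(adelicUnipotent (↥(maximalRealSubfield L)) L (IsCMField.complexConj L) 2)}
    (h𝓕N : IsFundamentalDomain ↥(rationalUnipotent (↥(maximalRealSubfield L)) L (IsCMField.complexConj L) 2) 𝓕 ν) (h𝓕c : IsCompact (closure 𝓕))
    {T : ℝ≥0} (hT : 1 ≤ T) (φ₀ : ℂ) {σ : ℝ} (hσ : 1 < σ)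
    (μ : Measure (quasiSplit (↥(maximalRealSubfield L)) L (IsCMField.complexConj L) 2).automorphicQuotient) [IsFiniteMeasure μ] (p : ℝ≥0∞) :
    MemLp ((quasiSplit (↥(maximalRealSubfield L)) L (IsCMField.complexConj L) 2).quotFun
      (truncation ν 𝓕 T (eisensteinSeriesU (flatSectionU (fun _ : (quasiSplit (↥(maximalRealSubfield L)) L (IsCMField.complexConj L) 2).Adelic => φ₀) ((σ : ℝ) : ℂ))))) p μ := by
  -- a trace-zero generator `δ = e − ē ≠ 0`
  obtain ⟨e, he⟩ := Literature.NumberTheory.NumberFields.IsCMField.exists_complexConj_ne L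
  have hcδ : IsCMField.complexConj L (e - IsCMField.complexConj L e) = -(e - IsCMField.complexConj L e) := by
    rw [map_sub, IsCMField.complexConj_apply_apply, neg_sub]
  have hδ : e - IsCMField.complexConj L e ≠ 0 := sub_ne_zero.2 (Ne.symm he)
  have hσ' : 1 < (((σ : ℝ) : ℂ)).re := by rwa [Complex.ofReal_re]
  -- the spherical decay letter on the one-point compact `{σ}`
  obtain ⟨M₁, hM₁⟩ := exists_bound_sub_borelConstantTerm_sphericalEisenstein_cm_two L hcδ hδ ν h𝓕N h𝓕c (m := Module.finrank ℚ ↥(maximalRealSubfield L) + 1)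
    (by push_cast; linarith) hT φ₀ (Kc := {((σ : ℝ) : ℂ)}) isCompact_singleton (fun w hw => by rw [mem_singleton_iff.1 hw]; exact hσ')
    (R := ‖((σ : ℝ) : ℂ)‖) (fun w hw => by rw [mem_singleton_iff.1 hw])
  exact memLp_quotFun_truncation_eisensteinSeriesU_flatSectionU_cm_two L ν h𝓕N hT hσ' continuous_const (M := ‖φ₀‖) (fun _ => le_rfl) (fun _ _ _ => rfl)
    (fun g hg => hM₁ _ (mem_singleton _) g hg) μ p

/-! ## §2 The head: the residue at `z = 1` of a level-`K′` flat Eisenstein series is the constant function `r` -/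

section Head

variable (μ : Measure (quasiSplit (↥(maximalRealSubfield L)) L (IsCMField.complexConj L) 2).automorphicQuotient) [(quasiSplit (↥(maximalRealSubfield L)) L (IsCMField.complexConj L) 2).IsAutomorphicMeasure μ]

/-- **T2 — THE RESIDUE AT `z = 1` OF THE CONTINUED LEVEL-`K′` EISENSTEIN SERIES IS THE CONSTANT FUNCTION `r`.**  DATA (the binders of the spherical ★ `residueValue_eq_const_cm_two` with the
constant section replaced by a level section): `ν` Haar on `N(𝔸)` with a fundamental domain `𝓕` of compact closure; a continuous bounded left-`N(𝔸)`∕`B(L⁺)`-invariant section `φ₁`;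
`T ≥ 1`; the continued values `Ẽ = Ec` on an open preconnected `D ⊇ B(1,ρ)∖{1}` containing a neighbourhood of a real tube point `σ₀ > 1`, holomorphic in `z`, continuous and locally bounded
in `g`, left-`G(L⁺)`-invariant, `= E(φ₁H^z)` on the tube ((E2)); the level constant-term letter (E3′) `Ẽ(z)_B(g) = φ₁(g)H(g)^z + ψ(z,g)H(g)^{1−z}` with `(z−1)ψ(z,g) → r`; the pole function
`F g` of `(z−1)Ẽ(z)(g)` at `1`; the operator road's family `Fam` holomorphic on `D` with `Fam z =ᵐ Λ^T Ẽ(z)` and `(z−1)•Fam z → Res`.  CONCLUSION: **`F g 1 = r` for every `g`** — ★ T1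
with (L-CT) ★ `integrableOn_and_setIntegral_residueValue_sub_eq_zero_level`, (L-AE) ★ `ae_eq_residueValue_sub_indicator_level`, (L-ORTH) ★ `horth_level_cm_two_of_letters₀` (its `hMbd` ★
`exists_bound_norm_borelConstantTerm_sub_flatSectionU_cm_two`, its `hTr` §1). [cite: MoeglinWaldspurger1995, IV.1.11] [cite: Langlands1976, §7] [cite: BernsteinLapid2019, §4] -/
theorem residueValue_eq_const_level_cm_two
    (ν : Measure ↥(adelicUnipotent (↥(maximalRealSubfield L)) L (IsCMField.complexConj L) 2)) [ν.IsHaarMeasure]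
    {𝓕 : Set ↥(adelicUnipotent (↥(maximalRealSubfield L)) L (IsCMField.complexConj L) 2)}
    (h𝓕N : IsFundamentalDomain ↥(rationalUnipotent (↥(maximalRealSubfield L)) L (IsCMField.complexConj L) 2) 𝓕 ν) (h𝓕c : IsCompact (closure 𝓕))
    {φ₁ : (quasiSplit (↥(maximalRealSubfield L)) L (IsCMField.complexConj L) 2).Adelic → ℂ} (hφc : Continuous φ₁) {M : ℝ} (hφM : ∀ x, ‖φ₁ x‖ ≤ M)
    (hφN : ∀ (u : ↥(adelicUnipotent (↥(maximalRealSubfield L)) L (IsCMField.complexConj L) 2)) (x : (quasiSplit (↥(maximalRealSubfield L)) L (IsCMField.complexConj L) 2).Adelic),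
      φ₁ ((u : (quasiSplit (↥(maximalRealSubfield L)) L (IsCMField.complexConj L) 2).Adelic) * x) = φ₁ x)
    (hφB : ∀ b ∈ borelU ((IsCMField.complexConj L : L ≃ₐ[↥(maximalRealSubfield L)] L) : L →+* L) ((StdForm.antidiagonal 2).over L),
      ∀ x : (quasiSplit (↥(maximalRealSubfield L)) L (IsCMField.complexConj L) 2).Adelic,
        φ₁ ((quasiSplit (↥(maximalRealSubfield L)) L (IsCMField.complexConj L) 2).toAdelic b * x) = φ₁ x)
    {T : ℝ≥0} (hT : 1 ≤ T)
    (Ec : ℂ → (quasiSplit (↥(maximalRealSubfield L)) L (IsCMField.complexConj L) 2).Adelic → ℂ) {D : Set ℂ} (hDo : IsOpen D) (hDc : IsPreconnected D)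
    {σ₀ : ℝ} (hσ₀ : 1 < σ₀) (hσD : ∀ᶠ z in 𝓝 ((σ₀ : ℝ) : ℂ), z ∈ D) {ρ : ℝ} (hρ : 0 < ρ) (hρD : ∀ z : ℂ, z ≠ 1 → dist z 1 < ρ → z ∈ D)
    (hEd : ∀ g, DifferentiableOn ℂ (fun z => Ec z g) D) (hE4 : ∀ z ∈ D, Continuous (Ec z))
    (hEbd : ∀ z₀ ∈ D, ∀ K : Set (quasiSplit (↥(maximalRealSubfield L)) L (IsCMField.complexConj L) 2).Adelic, IsCompact K → ∃ V ∈ 𝓝 z₀, ∃ M : ℝ, ∀ z ∈ V, ∀ g ∈ K, ‖Ec z g‖ ≤ M)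
    (hEcinv : ∀ z ∈ D, ∀ (γ : (quasiSplit (↥(maximalRealSubfield L)) L (IsCMField.complexConj L) 2).arithmeticSubgroup) (x : (quasiSplit (↥(maximalRealSubfield L)) L (IsCMField.complexConj L) 2).Adelic),
      Ec z ((γ : (quasiSplit (↥(maximalRealSubfield L)) L (IsCMField.complexConj L) 2).Adelic) * x) = Ec z x)
    (hE2 : ∀ z ∈ D, 1 < z.re → Ec z = eisensteinSeriesU (flatSectionU φ₁ z))
    (ψ : ℂ → (quasiSplit (↥(maximalRealSubfield L)) L (IsCMField.complexConj L) 2).Adelic → ℂ) {r : ℂ}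
    (hψ : ∀ g : (quasiSplit (↥(maximalRealSubfield L)) L (IsCMField.complexConj L) 2).Adelic, Tendsto (fun z : ℂ => (z - 1) * ψ z g) (𝓝[≠] 1) (𝓝 r))
    (hE3 : ∀ z ∈ D, ∀ g : (quasiSplit (↥(maximalRealSubfield L)) L (IsCMField.complexConj L) 2).Adelic,
      borelConstantTerm ν 𝓕 (Ec z) g = φ₁ g * (((borelHeight g : ℝ≥0) : ℝ) : ℂ) ^ z + ψ z g * (((borelHeight g : ℝ≥0) : ℝ) : ℂ) ^ (1 - z))
    (Fp : (quasiSplit (↥(maximalRealSubfield L)) L (IsCMField.complexConj L) 2).Adelic → ℂ → ℂ) (hF : ∀ g, AnalyticAt ℂ (Fp g) 1) (hFE : ∀ g, Fp g =ᶠ[𝓝[≠] 1] fun z => (z - 1) * Ec z g)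
    (Fam : ℂ → (quasiSplit (↥(maximalRealSubfield L)) L (IsCMField.complexConj L) 2).L2 μ) (hFd : DifferentiableOn ℂ Fam D)
    (hFam : ∀ z ∈ D, ((Fam z : (quasiSplit (↥(maximalRealSubfield L)) L (IsCMField.complexConj L) 2).L2 μ) : (quasiSplit (↥(maximalRealSubfield L)) L (IsCMField.complexConj L) 2).automorphicQuotient → ℂ) =ᵐ[μ]
      (quasiSplit (↥(maximalRealSubfield L)) L (IsCMField.complexConj L) 2).quotFun (truncation ν 𝓕 T (Ec z)))
    (Res : (quasiSplit (↥(maximalRealSubfield L)) L (IsCMField.complexConj L) 2).L2 μ) (hRes : Tendsto (fun z : ℂ => (z - 1) • Fam z) (𝓝[≠] 1) (𝓝 Res)) :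
    ∀ g : (quasiSplit (↥(maximalRealSubfield L)) L (IsCMField.complexConj L) 2).Adelic, Fp g 1 = r := by
  have hc : (IsCMField.complexConj L) * (IsCMField.complexConj L) = 1 := AlgEquiv.ext fun x => IsCMField.complexConj_apply_apply L x
  have hD1 : ∀ᶠ z in 𝓝[≠] (1 : ℂ), z ∈ D := by
    filter_upwards [inter_mem_nhdsWithin _ (ball_mem_nhds (1 : ℂ) hρ)] with z hz
    exact hρD z hz.1 (mem_ball.1 hz.2)
  -- the Siegel indicator class `ind := [𝟙_{T<w₁}]`
  have hm := memLp_quotFun_siegelIndicator (F := (↥(maximalRealSubfield L))) (E := L) (c := (IsCMField.complexConj L)) (N := 2) μ 2 T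
  -- the two letters of (L-ORTH): the tail bound (★ R90-C14-p01) and the spherical (Tr) letter (§1)
  have hMbd : ∀ z ∈ D, 1 < z.re → ∃ C : ℝ, ∀ g : (quasiSplit (↥(maximalRealSubfield L)) L (IsCMField.complexConj L) 2).Adelic, T < borelHeight g →
      ‖borelConstantTerm ν 𝓕 (eisensteinSeriesU (flatSectionU φ₁ z)) g - flatSectionU φ₁ z g‖ ≤ C := fun z _ hz =>
    exists_bound_norm_borelConstantTerm_sub_flatSectionU_cm_two L ν h𝓕N h𝓕c hφc hφM hφN hφB hz (one_pos.trans_le hT)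
  have hTr : ∀ σ : ℝ, 1 < σ → MemLp ((quasiSplit (↥(maximalRealSubfield L)) L (IsCMField.complexConj L) 2).quotFun
      (truncation ν 𝓕 T (eisensteinSeriesU (flatSectionU (fun _ : (quasiSplit (↥(maximalRealSubfield L)) L (IsCMField.complexConj L) 2).Adelic => ((M : ℝ) : ℂ)) ((σ : ℝ) : ℂ))))) 2 μ :=
    fun σ hσ => memLp_quotFun_truncation_sphericalEisenstein_cm_two L ν h𝓕N h𝓕c hT ((M : ℝ) : ℂ) hσ μ 2
  refine residueValue_eq_const_of_letters_cm_two L μ Ec hDo hρ hρD hEd hE4 hEbd hEcinv Fp hF hFE r ?_ Res ?_ (hm.toLp _) (fun _ => rfl) ?_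
  · -- (L-CT)
    intro ν' _ 𝓕' h𝓕' x
    exact integrableOn_and_setIntegral_residueValue_sub_eq_zero_level hc ν' h𝓕' ν h𝓕N φ₁ Ec hDo hρ hρD hEd hE4 hEbd hEcinv ψ hψ hE3 Fp hF hFE x
  · -- (L-AE)
    exact ae_eq_residueValue_sub_indicator_level μ ν h𝓕N hT φ₁ Ec hD1 hEcinv ψ hψ hE3 Fp hF hFE Fam hFam Res hRes
  · -- (L-ORTH)
    exact horth_level_cm_two_of_letters₀ L μ ν h𝓕N h𝓕c hφc hφM hφN hφB hT Ec hDo hDc hσ₀ hσD hD1 hE2 hMbd hTr Fam hFd hFam Res hRes (hm.toLp _) (fun _ => rfl) r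

/-! ## §3 The `det`-twist corollary -/

/-- **T2, TWISTED — `Res_{z=1}(Ẽ(z)(g)·Θ(g)) = r·Θ(g)`** for every unitary automorphic character `Θ` of `U(J₂)(𝔸_{L⁺})` (e.g. `Θ = ψ∘det`): §2 fed to ★ T1
`residue_detTwist_eq_const_mul_of_letters_cm_two` (★ `residue_twist`).  This is the level input of the R6-feed of ROAD-S8B2 (residues of the `det`-twisted level Eisenstein series are
multiples of `ψ∘det`). [cite: MoeglinWaldspurger1995, IV.1.11] [cite: Rogawski1990, §13.9 p. 229 (i)] -/
theorem residue_detTwist_eq_const_mul_level_cm_two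
    (ν : Measure ↥(adelicUnipotent (↥(maximalRealSubfield L)) L (IsCMField.complexConj L) 2)) [ν.IsHaarMeasure]
    {𝓕 : Set ↥(adelicUnipotent (↥(maximalRealSubfield L)) L (IsCMField.complexConj L) 2)}
    (h𝓕N : IsFundamentalDomain ↥(rationalUnipotent (↥(maximalRealSubfield L)) L (IsCMField.complexConj L) 2) 𝓕 ν) (h𝓕c : IsCompact (closure 𝓕))
    {φ₁ : (quasiSplit (↥(maximalRealSubfield L)) L (IsCMField.complexConj L) 2).Adelic → ℂ} (hφc : Continuous φ₁) {M : ℝ} (hφM : ∀ x, ‖φ₁ x‖ ≤ M)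
    (hφN : ∀ (u : ↥(adelicUnipotent (↥(maximalRealSubfield L)) L (IsCMField.complexConj L) 2)) (x : (quasiSplit (↥(maximalRealSubfield L)) L (IsCMField.complexConj L) 2).Adelic),
      φ₁ ((u : (quasiSplit (↥(maximalRealSubfield L)) L (IsCMField.complexConj L) 2).Adelic) * x) = φ₁ x)
    (hφB : ∀ b ∈ borelU ((IsCMField.complexConj L : L ≃ₐ[↥(maximalRealSubfield L)] L) : L →+* L) ((StdForm.antidiagonal 2).over L),
      ∀ x : (quasiSplit (↥(maximalRealSubfield L)) L (IsCMField.complexConj L) 2).Adelic,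
        φ₁ ((quasiSplit (↥(maximalRealSubfield L)) L (IsCMField.complexConj L) 2).toAdelic b * x) = φ₁ x)
    {T : ℝ≥0} (hT : 1 ≤ T)
    (Ec : ℂ → (quasiSplit (↥(maximalRealSubfield L)) L (IsCMField.complexConj L) 2).Adelic → ℂ) {D : Set ℂ} (hDo : IsOpen D) (hDc : IsPreconnected D)
    {σ₀ : ℝ} (hσ₀ : 1 < σ₀) (hσD : ∀ᶠ z in 𝓝 ((σ₀ : ℝ) : ℂ), z ∈ D) {ρ : ℝ} (hρ : 0 < ρ) (hρD : ∀ z : ℂ, z ≠ 1 → dist z 1 < ρ → z ∈ D)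
    (hEd : ∀ g, DifferentiableOn ℂ (fun z => Ec z g) D) (hE4 : ∀ z ∈ D, Continuous (Ec z))
    (hEbd : ∀ z₀ ∈ D, ∀ K : Set (quasiSplit (↥(maximalRealSubfield L)) L (IsCMField.complexConj L) 2).Adelic, IsCompact K → ∃ V ∈ 𝓝 z₀, ∃ M : ℝ, ∀ z ∈ V, ∀ g ∈ K, ‖Ec z g‖ ≤ M)
    (hEcinv : ∀ z ∈ D, ∀ (γ : (quasiSplit (↥(maximalRealSubfield L)) L (IsCMField.complexConj L) 2).arithmeticSubgroup) (x : (quasiSplit (↥(maximalRealSubfield L)) L (IsCMField.complexConj L) 2).Adelic),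
      Ec z ((γ : (quasiSplit (↥(maximalRealSubfield L)) L (IsCMField.complexConj L) 2).Adelic) * x) = Ec z x)
    (hE2 : ∀ z ∈ D, 1 < z.re → Ec z = eisensteinSeriesU (flatSectionU φ₁ z))
    (ψ : ℂ → (quasiSplit (↥(maximalRealSubfield L)) L (IsCMField.complexConj L) 2).Adelic → ℂ) {r : ℂ}
    (hψ : ∀ g : (quasiSplit (↥(maximalRealSubfield L)) L (IsCMField.complexConj L) 2).Adelic, Tendsto (fun z : ℂ => (z - 1) * ψ z g) (𝓝[≠] 1) (𝓝 r))
    (hE3 : ∀ z ∈ D, ∀ g : (quasiSplit (↥(maximalRealSubfield L)) L (IsCMField.complexConj L) 2).Adelic,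
      borelConstantTerm ν 𝓕 (Ec z) g = φ₁ g * (((borelHeight g : ℝ≥0) : ℝ) : ℂ) ^ z + ψ z g * (((borelHeight g : ℝ≥0) : ℝ) : ℂ) ^ (1 - z))
    (Fp : (quasiSplit (↥(maximalRealSubfield L)) L (IsCMField.complexConj L) 2).Adelic → ℂ → ℂ) (hF : ∀ g, AnalyticAt ℂ (Fp g) 1) (hFE : ∀ g, Fp g =ᶠ[𝓝[≠] 1] fun z => (z - 1) * Ec z g)
    (Fam : ℂ → (quasiSplit (↥(maximalRealSubfield L)) L (IsCMField.complexConj L) 2).L2 μ) (hFd : DifferentiableOn ℂ Fam D)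
    (hFam : ∀ z ∈ D, ((Fam z : (quasiSplit (↥(maximalRealSubfield L)) L (IsCMField.complexConj L) 2).L2 μ) : (quasiSplit (↥(maximalRealSubfield L)) L (IsCMField.complexConj L) 2).automorphicQuotient → ℂ) =ᵐ[μ]
      (quasiSplit (↥(maximalRealSubfield L)) L (IsCMField.complexConj L) 2).quotFun (truncation ν 𝓕 T (Ec z)))
    (Res : (quasiSplit (↥(maximalRealSubfield L)) L (IsCMField.complexConj L) 2).L2 μ) (hRes : Tendsto (fun z : ℂ => (z - 1) • Fam z) (𝓝[≠] 1) (𝓝 Res))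
    (Θ : (quasiSplit (↥(maximalRealSubfield L)) L (IsCMField.complexConj L) 2).AutomorphicCharacter)
    (Fp' : (quasiSplit (↥(maximalRealSubfield L)) L (IsCMField.complexConj L) 2).Adelic → ℂ → ℂ) (hF' : ∀ g, AnalyticAt ℂ (Fp' g) 1)
    (hFE' : ∀ g, Fp' g =ᶠ[𝓝[≠] 1] fun z => (z - 1) * (Ec z g * ((Θ g : ℂˣ) : ℂ))) :
    ∀ g : (quasiSplit (↥(maximalRealSubfield L)) L (IsCMField.complexConj L) 2).Adelic, Fp' g 1 = r * ((Θ g : ℂˣ) : ℂ) := by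
  have hc : (IsCMField.complexConj L) * (IsCMField.complexConj L) = 1 := AlgEquiv.ext fun x => IsCMField.complexConj_apply_apply L x
  have hD1 : ∀ᶠ z in 𝓝[≠] (1 : ℂ), z ∈ D := by
    filter_upwards [inter_mem_nhdsWithin _ (ball_mem_nhds (1 : ℂ) hρ)] with z hz
    exact hρD z hz.1 (mem_ball.1 hz.2)
  have hm := memLp_quotFun_siegelIndicator (F := (↥(maximalRealSubfield L))) (E := L) (c := (IsCMField.complexConj L)) (N := 2) μ 2 T
  have hMbd : ∀ z ∈ D, 1 < z.re → ∃ C : ℝ, ∀ g : (quasiSplit (↥(maximalRealSubfield L)) L (IsCMField.complexConj L) 2).Adelic, T < borelHeight g →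
      ‖borelConstantTerm ν 𝓕 (eisensteinSeriesU (flatSectionU φ₁ z)) g - flatSectionU φ₁ z g‖ ≤ C := fun z _ hz =>
    exists_bound_norm_borelConstantTerm_sub_flatSectionU_cm_two L ν h𝓕N h𝓕c hφc hφM hφN hφB hz (one_pos.trans_le hT)
  have hTr : ∀ σ : ℝ, 1 < σ → MemLp ((quasiSplit (↥(maximalRealSubfield L)) L (IsCMField.complexConj L) 2).quotFun
      (truncation ν 𝓕 T (eisensteinSeriesU (flatSectionU (fun _ : (quasiSplit (↥(maximalRealSubfield L)) L (IsCMField.complexConj L) 2).Adelic => ((M : ℝ) : ℂ)) ((σ : ℝ) : ℂ))))) 2 μ :=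
    fun σ hσ => memLp_quotFun_truncation_sphericalEisenstein_cm_two L ν h𝓕N h𝓕c hT ((M : ℝ) : ℂ) hσ μ 2
  refine residue_detTwist_eq_const_mul_of_letters_cm_two L μ Ec hDo hρ hρD hEd hE4 hEbd hEcinv Fp hF hFE r ?_ Res ?_ (hm.toLp _) (fun _ => rfl) ?_ Θ Fp' hF' hFE'
  · intro ν' _ 𝓕' h𝓕' x
    exact integrableOn_and_setIntegral_residueValue_sub_eq_zero_level hc ν' h𝓕' ν h𝓕N φ₁ Ec hDo hρ hρD hEd hE4 hEbd hEcinv ψ hψ hE3 Fp hF hFE x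
  · exact ae_eq_residueValue_sub_indicator_level μ ν h𝓕N hT φ₁ Ec hD1 hEcinv ψ hψ hE3 Fp hF hFE Fam hFam Res hRes
  · exact horth_level_cm_two_of_letters₀ L μ ν h𝓕N h𝓕c hφc hφM hφN hφB hT Ec hDo hDc hσ₀ hσD hD1 hE2 hMbd hTr Fam hFd hFam Res hRes (hm.toLp _) (fun _ => rfl) r

end Head

end Summit.HodgeConjecture.HodgeConjecture.Cruxes.H413.K2E1EisensteinResidueLevelConstantU2Final

end
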